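import Literature.AlgebraicGeometry.Motives.JacobianPrimeThetaDivisor
import Literature.AlgebraicGeometry.Motives.JacobianStepOneOpenTransport
import Literature.AlgebraicGeometry.Motives.AlgPointsFiniteFibres
import Literature.AlgebraicGeometry.Motives.JacobianBrillNoetherLocusPoints
import Literature.AlgebraicGeometry.Motives.CurveUniversalDivisor
import Literature.AlgebraicGeometry.Motives.JacobianDimensionOfBirationalSymmetricPower
import Literature.AlgebraicGeometry.Motives.VarietiesDimensionProofs
import Literature.AlgebraicGeometry.Resolution.AlterationsDimension
import HarnessLib

/-!
# `dim W̃_{g−1}(P) = g − 1` unconditionally; the prime theta divisor of a complex Jacobian EXISTS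

Layer `Literature/AlgebraicGeometry/Motives` (namespace `….Motives.Jacobian`).  KERNEL ONLY (theorems; no definition, no named fact, no instance,
no `sorry`).

Lange, *Abelian Varieties over the Complex Numbers* (2023), §4.2.1 Lemma 4.2.1 (ii): for a smooth projective curve `C` of genus `g` with Jacobian `J`
and `n ≤ g`, the locus `W̃_n = α_{nc}(C^{(n)}) ⊆ J` is an irreducible closed subvariety of DIMENSION `n`; Milne, *Jacobian Varieties*, §5: `W^r` is the
image of `C^r → J` and `f^{(r)} : C^{(r)} → W^r` is birational for `r ≤ g` (Thm. 5.1 (a)).  Here, for `r = dim J − 1`: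

* §1 (any algebraically closed field `k`, `C` a smooth proper geometrically integral `k`-curve with a Jacobian `𝒥`, base point `P`, any `r`)
  **`Jacobian.exists_isAlteration_lift_abelSum`**: GRANTED the `(r+1)`-fold uniqueness statement `hopen` («over a non-empty open of `J`, a point is an
  `(r+1)`-fold Abel sum `∏ⱼ α_P(τⱼ)` in exactly one way up to order», the `hopen` socket of the cell's Step-I chain, ★ p767413 at `r + 1 = dim J` over `ℂ`),
  the Abel sum map `α_{rP} : C^r → J` LIFTS through the integral closed subscheme `W ↪ J` on `W̃_r(P)` (reduced induced structure; Mathlib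
  `IsClosedImmersion.lift`, the source `C^r` being reduced) to an ALTERATION `C^r → W` (★ `AlgPoints.isAlteration_left_of_finite_nonempty_fibres`: proper,
  dominant, with finite non-empty `k`-point fibres over the `k`-points of a non-empty open — a fibre of `α_r` over `w` embeds into the finite fibre of
  `α_{r+1}` over `α_P(Q) · w`); hence (**`Jacobian.topologicalKrullDim_brillNoetherLocus_of_hopen`**) `dim W̃_r(P) = dim C^r = r`
  (★ `Resolution.IsAlteration.topologicalKrullDim_eq`, de Jong 2.20; ★ `smoothOfRelativeDimension_powOver_base`).
* §2 (smooth projective complex curve, `dim J ≥ 1`) **`Jacobian.topologicalKrullDim_brillNoetherLocus_eq`**: `dim W̃_{dim J−1}(P) = dim J − 1`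
  UNCONDITIONALLY (the `hopen` input is ★ `exists_opens_general_abelSum_of_isSmoothProjective`); hence `coheight η_{W̃} = 1` and, by ★ p767485
  `exists_prime_isRiemannThetaDivisor`, **the prime theta divisor `Θ_W = [W̃_{dim J−1}(P)]` EXISTS**: a Riemann theta divisor with support exactly
  `W̃_{dim J−1}(P)`, `Z(Θ_W)` integral, every effective divisor with that support `≈ a • Θ_W`
  (**`Jacobian.exists_prime_isRiemannThetaDivisor_of_isSmoothProjective`**; the letter `stub_V7a` of the cell's G5 skeleton is its projection
  `exists_isRiemannThetaDivisor_support_eq_isIntegral`).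

Use (cell `hodgecm-mathlib`, D-0151; crux HLiu418 = stmt-HodgeConjecture-24832): the OBJECT of interface row VI-7 (#67)
`Jacobian.riemann_brillNoetherLocus_isPrincipalPolarizationDivisor`, letter `stub_V7a` (pen A-p04 (g18), G5 sockets v1).  COUNT-NEUTRAL.  HC_CM is proved
only modulo the 7 printed citations until rung 0 closes; this file moves no book by itself.

## References
* [Lange2023AbelianVarietiesComplex] H. Lange, *Abelian Varieties over the Complex Numbers* (2023), §4.2.1 Lemma 4.2.1 (ii) and Cor. 4.2.4.
* [Milne1986JacobianVarieties] J. S. Milne, *Jacobian Varieties*, in Cornell–Silverman (1986), §5 (the maps `f^r : C^r → J`, Thm. 5.1 (a)), §6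
  (`Θ = W^{g−1}`, before Thm. 6.6).
* [DeJong1996] A. J. de Jong, *Smoothness, semi-stability and alterations*, Publ. Math. IHÉS 83 (1996), 2.20, p. 61.
* [Hartshorne1977] R. Hartshorne, *Algebraic Geometry* (1977), II Example 3.2.6 (reduced induced structure), II.6 Prop. 6.11.
-/

set_option autoImplicit false

noncomputable section

universe u

open CategoryTheory AlgebraicGeometry Order TopologicalSpace Opposite

namespace Literature.AlgebraicGeometry.Motives

namespace Jacobian

open RelativeSpec Literature.AlgebraicGeometry.Resolution Literature.AlgebraicGeometry.Dimension Scheme.IdealSheafData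

/-! ## §1 The Abel sum map lifts to an alteration `C^r → W̃_r(P)`, granted `(r+1)`-fold uniqueness -/

section AnyField

variable {k : Type u} [Field k] [IsAlgClosed k] {C : SchemeOver k} [SmoothOfRelativeDimension 1 C.hom] [IsProper C.hom]
  [GeometricallyIntegral C.hom] (𝒥 : Jacobian C) (P : AlgPoints C k) (r : ℕ)

omit [IsAlgClosed k] in
/-- The kernel of the Abel sum map `α_{rP} : C^r → J` is the vanishing ideal sheaf of `W̃_r(P)` (the source `C^r` is reduced, so `ker α` is the
vanishing ideal of the closure of the image; Mathlib `map_vanishingIdeal`). [cite: Hartshorne1977, II Example 3.2.6] -/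
theorem ker_abelSum_left_eq_vanishingIdeal :
    (𝒥.abelSum P r).left.ker = vanishingIdeal ⟨𝒥.brillNoetherLocus P r, 𝒥.isClosed_brillNoetherLocus P r⟩ := by
  haveI : IsIntegral (powOverObj C.hom r).left := (CurvePlaces.isIntegral_powOver_hom C r).1
  have hZ : (⟨𝒥.brillNoetherLocus P r, 𝒥.isClosed_brillNoetherLocus P r⟩ : Closeds 𝒥.J.X.left) =
      Closeds.closure ((𝒥.abelSum P r).left '' ((⊤ : Closeds (powOverObj C.hom r).left) : Set (powOverObj C.hom r).left)) := by
    ext1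
    simp only [Closeds.coe_closure, Closeds.coe_top, Set.image_univ]
    rfl
  rw [hZ, ← map_vanishingIdeal, vanishingIdeal_top, Scheme.nilradical_eq_bot, map_bot]

/-- **The Abel sum map lifts to an ALTERATION onto `W̃_r(P)` (reduced structure), granted `(r+1)`-fold uniqueness** (Milne §5: `f^{(r)} : C^{(r)} → W^r`
birational for `r ≤ g`; here only «generically finite»): there is `φ : C^r → W` with `φ ≫ ι_W = α_{rP}` which is an alteration in the sense of ★
`Resolution.IsAlteration` (integral source, proper, dominant, finite over a non-empty open).  The `k`-point fibre of `α_r` over `w` injects, by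
`z ↦ (coordinates of z, Q)`, into the fibre of `α_{r+1}` over `w · α_P(Q)`, which `hopen` makes a single `𝔖_{r+1}`-orbit for `w · α_P(Q)` in its open.
[cite: Milne1986JacobianVarieties, §5 (the maps f^r : C^r → J) and Thm. 5.1 (a)] [cite: Lange2023AbelianVarietiesComplex, §4.2.1 Lemma 4.2.1 (ii)]
[cite: DeJong1996, 2.20, p. 61] -/
theorem exists_isAlteration_lift_abelSum
    (hopen : ∃ U₁ : 𝒥.J.X.left.Opens, (U₁ : Set 𝒥.J.X.left).Nonempty ∧
      ∀ a : 𝒥.J.Points k, a.pt ∈ U₁ → ∃ τ : Fin (r + 1) → AlgPoints C k,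
        (∏ j : Fin (r + 1), τ j ≫ 𝒥.abelJacobi P) = a ∧
        ∀ τ' : Fin (r + 1) → AlgPoints C k, (∏ j : Fin (r + 1), τ' j ≫ 𝒥.abelJacobi P) = a →
          ∃ σ : Equiv.Perm (Fin (r + 1)), τ' = τ ∘ σ) :
    ∃ φ : (powOverObj C.hom r).left ⟶
        (vanishingIdeal (⟨𝒥.brillNoetherLocus P r, 𝒥.isClosed_brillNoetherLocus P r⟩ : Closeds 𝒥.J.X.left)).subscheme,
      φ ≫ (vanishingIdeal (⟨𝒥.brillNoetherLocus P r, 𝒥.isClosed_brillNoetherLocus P r⟩ : Closeds 𝒥.J.X.left)).subschemeι =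
        (𝒥.abelSum P r).left ∧ IsAlteration φ := by
  classical
  haveI : IsIntegral (powOverObj C.hom r).left := (CurvePlaces.isIntegral_powOver_hom C r).1
  haveI : LocallyOfFiniteType 𝒥.J.X.hom := 𝒥.J.isProper.toLocallyOfFiniteType
  set Z : Closeds 𝒥.J.X.left := ⟨𝒥.brillNoetherLocus P r, 𝒥.isClosed_brillNoetherLocus P r⟩ with hZdef
  set I := vanishingIdeal Z with hIdef
  set α := 𝒥.abelSum P r with hαdef
  -- the lift through the reduced closed subscheme on `W̃_r(P)`
  have hker : I.subschemeι.ker ≤ α.left.ker := by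
    rw [ker_subschemeι, hIdef, hZdef, ← 𝒥.ker_abelSum_left_eq_vanishingIdeal P r]
  let φ : (powOverObj C.hom r).left ⟶ I.subscheme := IsClosedImmersion.lift I.subschemeι α.left hker
  have hφ : φ ≫ I.subschemeι = α.left := IsClosedImmersion.lift_fac _ _ _
  refine ⟨φ, hφ, ?_⟩
  -- the target as a `k`-scheme and the lift as a `k`-morphism
  let W : SchemeOver k := Over.mk (I.subschemeι ≫ 𝒥.J.X.hom)
  let ιO : W ⟶ 𝒥.J.X := Over.homMk I.subschemeι rfl
  let ψ : powOverObj C.hom r ⟶ W := Over.homMk φ (by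
    change φ ≫ I.subschemeι ≫ 𝒥.J.X.hom = (powOverObj C.hom r).hom
    rw [← Category.assoc, hφ]
    exact Over.w α)
  have hψι : ψ ≫ ιO = α := by
    ext1
    exact hφ
  -- instances: `W` integral and of finite type, `φ` proper
  haveI : IsIntegral W.left := isIntegral_subscheme_vanishingIdeal Z (𝒥.isIrreducible_brillNoetherLocus P r)
  haveI : LocallyOfFiniteType W.hom := inferInstanceAs (LocallyOfFiniteType (I.subschemeι ≫ 𝒥.J.X.hom))
  haveI : IsProper (α.left ≫ 𝒥.J.X.hom) := by
    rw [Over.w α]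
    exact isProper_powOver_base C.hom r
  haveI : IsProper α.left := IsProper.of_comp α.left 𝒥.J.X.hom
  haveI : IsProper (φ ≫ I.subschemeι) := by rw [hφ]; infer_instance
  haveI : IsProper φ := IsProper.of_comp φ I.subschemeι
  haveI : IsProper ψ.left := inferInstanceAs (IsProper φ)
  haveI : Mono I.subschemeι := ((IsClosedImmersion.iff_isFinite_and_mono I.subschemeι).mp inferInstance).2
  haveI : Mono ιO.left := inferInstanceAs (Mono I.subschemeι)
  haveI : Mono ιO := Over.mono_of_mono_left ιO
  have hrange : Set.range I.subschemeι.base = 𝒥.brillNoetherLocus P r := range_subschemeι_vanishingIdeal Z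
  -- `k`-points over `a ∈ W(k)` versus `k`-points of `C^r` with Abel sum `ι a`
  have hfibre : ∀ (a : AlgPoints W k) (z : AlgPoints (powOverObj C.hom r) k),
      AlgPoints.map ψ z = a ↔ z ≫ α = AlgPoints.map ιO a := by
    intro a z
    constructor
    · intro h
      change z ≫ ψ = a at h
      change z ≫ α = a ≫ ιO
      rw [← h, Category.assoc, hψι]
    · intro h
      change z ≫ α = a ≫ ιO at h
      change z ≫ ψ = a
      rw [← hψι, ← Category.assoc] at h
      exact (cancel_mono ιO).mp h
  -- the open `U ⊆ W`: points `w` with `w · α_P(Q)` in the open of `hopen` for some `Q`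
  obtain ⟨U₁, hU₁, huniq⟩ := hopen
  let V' : 𝒥.J.X.left.Opens := ⨆ Q : AlgPoints C k, (𝒥.J.translation (Q ≫ 𝒥.abelJacobi P)).left ⁻¹ᵁ U₁
  let U : W.left.Opens := I.subschemeι ⁻¹ᵁ V'
  have hmemV' : ∀ x : 𝒥.J.Points k, x.pt ∈ V' ↔ ∃ Q : AlgPoints C k, (x * (Q ≫ 𝒥.abelJacobi P)).pt ∈ U₁ := by
    intro x
    simp only [V', Opens.mem_iSup]
    refine exists_congr fun Q => ?_
    have hmap : AlgPoints.map (𝒥.J.translation (Q ≫ 𝒥.abelJacobi P)) x = x * (Q ≫ 𝒥.abelJacobi P) :=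
      (𝒥.J.comp_translation x (Q ≫ 𝒥.abelJacobi P)).trans (mul_comm _ _)
    change (𝒥.J.translation (Q ≫ 𝒥.abelJacobi P)).left.base x.pt ∈ U₁ ↔ _
    rw [← AlgPoints.pt_map, hmap]
  refine AlgPoints.isAlteration_left_of_finite_nonempty_fibres ψ U ?_ ?_ ?_
  · -- `U` is non-empty: an `(r+1)`-fold Abel sum in `U₁` is `w · α_P(Q)` with `w ∈ W̃_r(P)`
    haveI : JacobsonSpace 𝒥.J.X.left := LocallyOfFiniteType.jacobsonSpace 𝒥.J.X.hom
    obtain ⟨x₁, hx₁U, hx₁cl⟩ := nonempty_inter_closedPoints hU₁ U₁.2.isLocallyClosed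
    obtain ⟨a₁, ha₁⟩ := AlgPoints.exists_pt_eq_of_isClosed_singleton (X := 𝒥.J.X) (mem_closedPoints_iff.mp hx₁cl)
    obtain ⟨τ, hτ, -⟩ := huniq a₁ (ha₁ ▸ hx₁U)
    set w' : 𝒥.J.Points k := ∏ j : Fin r, τ (Fin.castSucc j) ≫ 𝒥.abelJacobi P with hw'
    have hw'W : w'.pt ∈ 𝒥.brillNoetherLocus P r := (𝒥.pt_mem_brillNoetherLocus_iff P r w').mpr ⟨_, rfl⟩
    rw [← hrange] at hw'W
    obtain ⟨w, hw⟩ := hw'W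
    refine ⟨w, ?_⟩
    change I.subschemeι.base w ∈ (V' : Set 𝒥.J.X.left)
    rw [hw]
    refine (hmemV' w').mpr ⟨τ (Fin.last r), ?_⟩
    have hsplit : (∏ j : Fin r, τ (Fin.castSucc j) ≫ 𝒥.abelJacobi P) * (τ (Fin.last r) ≫ 𝒥.abelJacobi P) =
        ∏ j : Fin (r + 1), τ j ≫ 𝒥.abelJacobi P :=
      (Fin.prod_univ_castSucc (fun j => τ j ≫ 𝒥.abelJacobi P)).symm
    rw [hw', hsplit, hτ, ha₁]
    exact hx₁U
  · -- finiteness of the `k`-point fibres over `U`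
    intro a haU
    set x := AlgPoints.map ιO a with hx
    have hxV : x.pt ∈ V' := by
      rw [hx, AlgPoints.pt_map]
      exact haU
    obtain ⟨Q, hQ⟩ := (hmemV' x).mp hxV
    obtain ⟨τ₀, -, huniq₀⟩ := huniq (x * (Q ≫ 𝒥.abelJacobi P)) hQ
    -- each `z` over `a` gives an `(r+1)`-tuple with Abel sum `x · α_P(Q)`, hence a permutation of `τ₀`
    have key : ∀ z : {z : AlgPoints (powOverObj C.hom r) k | AlgPoints.map ψ z = a},
        ∃ σ : Equiv.Perm (Fin (r + 1)),
          (Fin.snoc (fun j : Fin r => (z : AlgPoints (powOverObj C.hom r) k) ≫ (projOver C.hom r j : powOverObj C.hom r ⟶ C)) Q :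
            Fin (r + 1) → AlgPoints C k) = τ₀ ∘ σ := by
      rintro ⟨z, hz⟩
      apply huniq₀
      have hz' : z ≫ α = x := (hfibre a z).mp hz
      rw [hαdef, comp_abelSum_eq_prod] at hz'
      rw [Fin.prod_univ_castSucc]
      simp only [Fin.snoc_castSucc, Fin.snoc_last]
      exact congrArg (· * (Q ≫ 𝒥.abelJacobi P)) hz'
    choose σ hσ using key
    have hinj : Function.Injective σ := by
      rintro ⟨z, hz⟩ ⟨z', hz'⟩ h
      have h1 := hσ ⟨z, hz⟩
      have h2 := hσ ⟨z', hz'⟩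
      rw [h, ← h2] at h1
      apply Subtype.ext
      refine hom_ext_projOver C.hom r z z' fun j => ?_
      have := congrFun h1 (Fin.castSucc j)
      simp only [Fin.snoc_castSucc] at this
      exact this
    exact Set.finite_coe_iff.mp (Finite.of_injective σ hinj)
  · -- non-emptiness of the `k`-point fibres over `U` (indeed over all of `W`)
    intro a _
    set x := AlgPoints.map ιO a with hx
    have hxW : x.pt ∈ 𝒥.brillNoetherLocus P r := by
      rw [hx, AlgPoints.pt_map, ← hrange]
      exact ⟨a.pt, rfl⟩
    obtain ⟨τ, hτ⟩ := (𝒥.pt_mem_brillNoetherLocus_iff P r x).mp hxW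
    refine ⟨liftOver C.hom r τ, (hfibre a _).mpr ?_⟩
    rw [hαdef, liftOver_comp_abelSum, hτ]

/-- **`dim W̃_r(P) = r`, granted `(r+1)`-fold uniqueness** (Lange Lemma 4.2.1 (ii), Milne §5): `C^r → W̃_r(P)` is an alteration (above), alterations
preserve dimension (★ de Jong 2.20), `dim C^r = r` (★ `smoothOfRelativeDimension_powOver_base`), and a closed immersion is a homeomorphism onto its
range. [cite: Lange2023AbelianVarietiesComplex, §4.2.1 Lemma 4.2.1 (ii)] [cite: Milne1986JacobianVarieties, §5 (the maps f^r : C^r → J) and Thm. 5.1 (a)]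
[cite: DeJong1996, 2.20, p. 61] -/
theorem topologicalKrullDim_brillNoetherLocus_of_hopen
    (hopen : ∃ U₁ : 𝒥.J.X.left.Opens, (U₁ : Set 𝒥.J.X.left).Nonempty ∧
      ∀ a : 𝒥.J.Points k, a.pt ∈ U₁ → ∃ τ : Fin (r + 1) → AlgPoints C k,
        (∏ j : Fin (r + 1), τ j ≫ 𝒥.abelJacobi P) = a ∧
        ∀ τ' : Fin (r + 1) → AlgPoints C k, (∏ j : Fin (r + 1), τ' j ≫ 𝒥.abelJacobi P) = a →
          ∃ σ : Equiv.Perm (Fin (r + 1)), τ' = τ ∘ σ) :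
    topologicalKrullDim ↥(𝒥.brillNoetherLocus P r) = (r : WithBot ℕ∞) := by
  haveI : IsIntegral (powOverObj C.hom r).left := (CurvePlaces.isIntegral_powOver_hom C r).1
  haveI : LocallyOfFiniteType 𝒥.J.X.hom := 𝒥.J.isProper.toLocallyOfFiniteType
  set Z : Closeds 𝒥.J.X.left := ⟨𝒥.brillNoetherLocus P r, 𝒥.isClosed_brillNoetherLocus P r⟩ with hZdef
  obtain ⟨φ, -, hφ⟩ := 𝒥.exists_isAlteration_lift_abelSum P r hopen
  haveI : IsIntegral (vanishingIdeal Z).subscheme := isIntegral_subscheme_vanishingIdeal Z (𝒥.isIrreducible_brillNoetherLocus P r)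
  haveI : LocallyOfFiniteType ((vanishingIdeal Z).subschemeι ≫ 𝒥.J.X.hom) := inferInstance
  -- `dim W = dim C^r`
  have h1 := hφ.topologicalKrullDim_eq ((vanishingIdeal Z).subschemeι ≫ 𝒥.J.X.hom)
  -- `dim C^r = r`
  haveI : SmoothOfRelativeDimension r (powOverObj C.hom r).hom := by
    have h := smoothOfRelativeDimension_powOver_base C.hom 1 r
    rw [Nat.mul_one] at h
    exact h
  have h2 : topologicalKrullDim (powOverObj C.hom r).left = r :=
    topologicalKrullDim_eq_of_smoothOfRelativeDimension (powOverObj C.hom r).hom r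
  -- `dim W = dim W̃_r(P)` (closed immersion = homeomorphism onto its range)
  have hrange : Set.range (vanishingIdeal Z).subschemeι.base = 𝒥.brillNoetherLocus P r := range_subschemeι_vanishingIdeal Z
  let e : ((vanishingIdeal Z).subscheme : Type u) ≃ₜ ↥(𝒥.brillNoetherLocus P r) :=
    (vanishingIdeal Z).subschemeι.isClosedEmbedding.isEmbedding.toHomeomorph.trans (Homeomorph.setCongr hrange)
  have h3 := IsHomeomorph.topologicalKrullDim_eq e e.isHomeomorph
  rw [← h3, ← h1, h2]

end AnyField

/-! ## §2 Complex Jacobians: `dim W̃_{dim J − 1}(P) = dim J − 1` and the prime theta divisor exists -/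

section Complex

variable {C : SchemeOver ℂ} [IsIntegral C.left] [IsLocallyNoetherian C.left] (𝒥 : Jacobian C) (hC : IsSmoothProjective 1 C)
  (hdim : 1 ≤ 𝒥.J.dim) (P : AlgPoints C ℂ)

include hC hdim in
/-- **`dim W̃_{dim J−1}(P) = dim J − 1` for the Jacobian of a smooth projective complex curve** (`dim J ≥ 1`), UNCONDITIONALLY — the `dim J`-fold
uniqueness is ★ `exists_opens_general_abelSum_of_isSmoothProjective`. Lange Lemma 4.2.1 (ii) at `n = g − 1`.
[cite: Lange2023AbelianVarietiesComplex, §4.2.1 Lemma 4.2.1 (ii)] [cite: Milne1986JacobianVarieties, §5 (the maps f^r : C^r → J) and Thm. 5.1 (a)] -/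
theorem topologicalKrullDim_brillNoetherLocus_eq :
    topologicalKrullDim ↥(𝒥.brillNoetherLocus P (𝒥.J.dim - 1)) = ((𝒥.J.dim - 1 : ℕ) : WithBot ℕ∞) := by
  haveI : SmoothOfRelativeDimension 1 C.hom := hC.smoothOfRelativeDimension
  haveI : IsProper C.hom := IsSmoothProjective.isProper_holds hC
  haveI : GeometricallyIntegral C.hom := IsSmoothProjective.geometricallyIntegral_holds hC
  obtain ⟨U₁, hU₁, h⟩ := 𝒥.exists_opens_general_abelSum_of_isSmoothProjective hC hdim P
  exact 𝒥.topologicalKrullDim_brillNoetherLocus_of_hopen P (𝒥.J.dim - 1)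
    ⟨U₁, hU₁, fun a ha => by
      obtain ⟨τ, -, hτ, hu⟩ := h a ha
      exact ⟨τ, hτ, hu⟩⟩

include hC hdim in
/-- **`coheight η_{W̃_{dim J−1}(P)} = 1` unconditionally** (smooth projective complex curve, `dim J ≥ 1`): `W̃_{g−1}` is a prime (Weil) divisor of
`J`. [cite: Lange2023AbelianVarietiesComplex, §4.2.1 Lemma 4.2.1 (ii) and Cor. 4.2.4] -/
theorem coheight_genericPoint_brillNoetherLocus_eq_one_of_isSmoothProjective :
    haveI : GeometricallyIrreducible C.hom := hC.geometricallyIrreducible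
    Order.coheight (𝒥.isIrreducible_brillNoetherLocus P (𝒥.J.dim - 1)).genericPoint = 1 := by
  haveI : GeometricallyIrreducible C.hom := hC.geometricallyIrreducible
  exact 𝒥.coheight_genericPoint_brillNoetherLocus_eq_one P hdim _ (𝒥.topologicalKrullDim_brillNoetherLocus_eq hC hdim P)

include hC hdim in
/-- **The prime theta divisor of a complex Jacobian EXISTS** (smooth projective curve, `dim J ≥ 1`, base point `P`): an effective Cartier divisor
`Θ_W` which is a Riemann theta divisor with support EXACTLY `W̃_{dim J−1}(P)`, ideal sheaf `vanishingIdeal W̃`, integral closed subscheme `Z(Θ_W)`, and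
such that every effective divisor with support `W̃_{dim J−1}(P)` is `≈ a • Θ_W`, `a ≥ 1` (★ p767485 `exists_prime_isRiemannThetaDivisor` with its
hypothesis `coheight = 1` discharged by §2). Lange Cor. 4.2.4 («`W̃_{g−1}` is a theta divisor», the divisor part); Milne §6 `Θ = W^{g−1}`.
[cite: Lange2023AbelianVarietiesComplex, §4.2.1 Lemma 4.2.1 (ii) and Cor. 4.2.4] [cite: Milne1986JacobianVarieties, §6 (Θ = W^{g-1}, before Thm. 6.6)] -/
theorem exists_prime_isRiemannThetaDivisor_of_isSmoothProjective :
    ∃ (Θ : CartierDivisor 𝒥.J.X.left) (hΘ : Θ.IsEffective), 𝒥.IsRiemannThetaDivisor Θ ∧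
      (Θ.nonvanishing 1)ᶜ = 𝒥.brillNoetherLocus P (𝒥.J.dim - 1) ∧
      hΘ.idealSheaf = vanishingIdeal ⟨𝒥.brillNoetherLocus P (𝒥.J.dim - 1), 𝒥.isClosed_brillNoetherLocus P _⟩ ∧
      IsIntegral hΘ.idealSheaf.subscheme ∧
      ∀ D : CartierDivisor 𝒥.J.X.left, D.IsEffective → (D.nonvanishing 1)ᶜ = 𝒥.brillNoetherLocus P (𝒥.J.dim - 1) →
        ∃ a : ℕ, 0 < a ∧ D.SameDivisor (a • Θ) := by
  haveI : GeometricallyIrreducible C.hom := hC.geometricallyIrreducible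
  exact 𝒥.exists_prime_isRiemannThetaDivisor P (𝒥.coheight_genericPoint_brillNoetherLocus_eq_one_of_isSmoothProjective hC hdim P)

include hC hdim in
/-- **Letter `stub_V7a` of the cell's G5 skeleton** (row VI-7): the prime theta divisor — an effective Riemann theta divisor with support EXACTLY
`W̃_{dim J−1}(P)` and integral `Z(Θ)` — exists for every smooth projective complex curve, Jacobian of dimension `≥ 1` and base point.
[cite: Lange2023AbelianVarietiesComplex, §4.2.1 Lemma 4.2.1 (ii) and Cor. 4.2.4] [cite: Milne1986JacobianVarieties, §6 (Θ = W^{g-1}, before Thm. 6.6)] -/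
theorem exists_isRiemannThetaDivisor_support_eq_isIntegral :
    ∃ (Θ : CartierDivisor 𝒥.J.X.left) (hΘ : Θ.IsEffective), 𝒥.IsRiemannThetaDivisor Θ ∧
      (Θ.nonvanishing 1)ᶜ = 𝒥.brillNoetherLocus P (𝒥.J.dim - 1) ∧ IsIntegral hΘ.idealSheaf.subscheme := by
  obtain ⟨Θ, hΘ, h1, h2, -, h4, -⟩ := 𝒥.exists_prime_isRiemannThetaDivisor_of_isSmoothProjective hC hdim P
  exact ⟨Θ, hΘ, h1, h2, h4⟩

end Complex

end Jacobian

end Literature.AlgebraicGeometry.Motives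

end
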